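import Summits.BirchSwinnertonDyer.BirchSwinnertonDyer.Theorems.PrintX11aMultThreeOrbitDecomposition
import HarnessLib

/-!
# Route `PrintX11a`, crux U3 `UpperNonSurjThree` (item stmt-BirchSwinnertonDyer-20613), line finemu3 — μ-road stub
# `stub_muAnHardThree`: the ATKIN–LEHNER-EXTENDED ORBIT TRICK in `GL₂(ℤ[1/3])`, part 3/3 (THE KERNEL THEOREM)

Cell `bsd-print-x11a`, width seat bsd-line-x11a-p2 g2 (`--supports stmt-BirchSwinnertonDyer-20613 --as helper`). BSD is not
proved by any of this; nothing is asserted about any curve. Pure group theory; parts 1/3, 2/3 supply the objects,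
the normal form, (h3), (h3′) and (V).

THIS FILE (3/3). An ABSTRACT PERIOD DATUM on `Γ₀(N)` (`N = 3M`, `3 ∤ M`): a homomorphism `m : Γ₀(N) → ℚ`, a sign
`σ = ±1` with `m(γ') = σ·m(γ)` whenever `γ' W = W γ` (`W`-equivariance — for the period functional of a newform this is
the Atkin–Lehner eigen-equation, sibling file `…MultThreeAtkinLehnerPeriods`), `γ₀` with `W W = 3 γ₀`, `κ ∈ ℚ` with
`(1 + σ) κ = m γ₀`, and a subgroup `Z ≤ ℚ` (think `3ℤ₍₃₎ ∩ ℚ`, "`≡ 0 (mod 3)`").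
* `periodSubgroup` — `S = {3ᵏ γ Wⁱ : m γ + i κ ∈ Z} ≤ GL₂(ℤ[1/3])` IS A SUBGROUP (the crossed-homomorphism identity
  behind it: `M(gh) = M(g) + σ^{i(g)} M(h)`), existential in the normal form;
* (h1) `Γ* ∩ P* ⊆ S` ⟸ `m γ ∈ Z` when `γ₀₁ = 0` (a `W`-type element never fixes `0`: class `[1/3] ≠ [0]`);
* (h2) `Γ* ∩ B*P* ⊆ S` ⟸ `m γ ∈ Z` when `d = ±1`, and `m γ + κ ∈ Z` when `|c y + 3 d| = 3ᵉ`, `e ≥ 1`;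
* `normalForm_unique` — `det` separates: `mapGL γ = 3ᵏ γ' Wⁱ` forces `i = k = 0`, `γ' = γ`;
* **`mem_of_orbitTrick`** — THE KERNEL THEOREM: under the three local hypotheses, `m γ ∈ Z` for EVERY `γ ∈ Γ₀(N)` with
  `d ≡ ±3ᵏ (mod M)` (in particular on `Γ₁(N)`): (V) puts `mapGL γ` in `⟨B* ∪ P*⟩`, the tree's abstract orbit lemma
  `ConjSpanGenAllLevels.OrbitTrick.mem_of_mem_closure` puts it in `S`, uniqueness reads off `m γ ∈ Z`.
This is the multiplicative-level replacement for THEOREM B (`ConjSpanGen`, vacuous at `3 ∣ N`).  beyond-print: yes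
(not in print).  References: [Vaserstein1972SL2] Theorem; [Manin1972] Prop. 1.4; [Knapp1993] Lemma 9.24.
-/

set_option linter.dupNamespace false
set_option autoImplicit false

namespace Summit.BirchSwinnertonDyer.BirchSwinnertonDyer.Theorems.MultThreeOrbit

open scoped MatrixGroups
open CongruenceSubgroup Matrix.SpecialLinearGroup
open Summit.BirchSwinnertonDyer.BirchSwinnertonDyer.Theorems.ConjSpanGenAllLevels
  Literature.NumberTheory.EllipticCurves.Rank1Residual

noncomputable section

/-! ### THE KERNEL: the orbit trick for `(Γ*, D*, B*, P*)` with an abstract period datum `(m, σ, κ, Z)` -/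

section Kernel

variable {N M : ℕ} {x y : ℤ} (hbez : 3 * x - M * y = 1) (hNM : N = 3 * M) (h3M : ¬ 3 ∣ M) (hM : 0 < M)

/-- `3 ∤ y` when `3x − My = 1`. [folklore] -/
theorem not_three_dvd_y (hbez : 3 * x - M * y = 1) : ¬ (3 : ℤ) ∣ y := by
  rintro ⟨t, rfl⟩
  have : (3 : ℤ) ∣ 1 := ⟨x - M * t, by linear_combination -hbez⟩
  omega

omit hbez in
/-- `3 ∤ d` for `γ = (a b; c d) ∈ Γ₀(N)`, `3 ∣ N`. [folklore] -/
theorem not_three_dvd_d (hNM : N = 3 * M) (γ : Gamma0 N) : ¬ (3 : ℤ) ∣ (γ : SL(2, ℤ)) 1 1 := by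
  intro hd
  have hc : (3 : ℤ) ∣ (γ : SL(2, ℤ)) 1 0 :=
    dvd_trans ⟨(M : ℤ), by rw [hNM]; push_cast; ring⟩ (dvd_of_mem_Gamma0 γ.2)
  have hdet := Matrix.SpecialLinearGroup.det_coe (γ : SL(2, ℤ))
  rw [Matrix.det_fin_two] at hdet
  have : (3 : ℤ) ∣ 1 := by
    rw [← hdet]; exact dvd_sub (dvd_mul_of_dvd_right hd _) (dvd_mul_of_dvd_right hc _)
  omega

/-- The powers of `3` are distinct units of `ℤ[1/3]`: `3ⁿ = 1 ⇒ n = 0`. [folklore] -/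
theorem three_zpow_eq_one {n : ℤ} (h : (three : Aˣ) ^ n = 1) : n = 0 := by
  have key : ∀ k : ℕ, (three : Aˣ) ^ k = 1 → k = 0 := by
    intro k hk
    have h1 : (((3 : ℤ) ^ k : ℤ) : A) = ((1 : ℤ) : A) := by
      have := congrArg (fun u : Aˣ ↦ (u : A)) hk
      simpa using this
    have h2 : (3 : ℤ) ^ k = 1 := intCast_injective (p := 3) (by norm_num) h1
    rcases Nat.eq_zero_or_pos k with hk0 | hk0
    · exact hk0
    · exfalso
      have : (3 : ℤ) ^ k ≥ 3 ^ 1 := pow_le_pow_right₀ (by norm_num) hk0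
      omega
  rcases le_or_gt 0 n with hn | hn
  · have := key n.toNat (by rwa [← zpow_natCast, Int.toNat_of_nonneg hn])
    omega
  · have h' : (three : Aˣ) ^ (-n) = 1 := by rw [zpow_neg, h, inv_one]
    have := key (-n).toNat (by rwa [← zpow_natCast, Int.toNat_of_nonneg (by omega)])
    omega

/-- `det W = 3`, `det (3·1) = 9`: the determinant of a normal form is `3^(2k+i)`. [folklore] -/
theorem det_normalForm (k : ℤ) (γ : Gamma0 N) (i : ℕ) :
    Matrix.GeneralLinearGroup.det (s3 ^ k * mapGL A (γ : SL(2, ℤ)) * WA hbez ^ i) =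
      three ^ (2 * k + i) := by
  have hW : Matrix.GeneralLinearGroup.det (WA hbez) = three := by
    rw [WA, map_mul, Matrix.SpecialLinearGroup.det_mapGL, one_mul, det_diag2, mul_one]
  have hs : Matrix.GeneralLinearGroup.det (s3 : G) = three ^ (2 : ℤ) := by
    rw [s3, Matrix.GeneralLinearGroup.det_scalar, Fintype.card_fin]; norm_cast
  rw [map_mul, map_mul, map_zpow, map_pow, Matrix.SpecialLinearGroup.det_mapGL, mul_one, hW, hs,
    ← zpow_mul, ← zpow_natCast, ← zpow_add]

/-- **Uniqueness of the trivial normal form**: `mapGL γ = 3ᵏ γ' Wⁱ` forces `i = 0`, `k = 0`, `γ' = γ`.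
[folklore] -/
theorem normalForm_unique {γ γ' : Gamma0 N} {k : ℤ} {i : ℕ} (hi : i ≤ 1)
    (h : (mapGL A (γ : SL(2, ℤ)) : G) = s3 ^ k * mapGL A (γ' : SL(2, ℤ)) * WA hbez ^ i) :
    i = 0 ∧ k = 0 ∧ γ' = γ := by
  have hdet := congrArg Matrix.GeneralLinearGroup.det h
  rw [det_normalForm, Matrix.SpecialLinearGroup.det_mapGL] at hdet
  have h0 := three_zpow_eq_one hdet.symm
  have hi0 : i = 0 := by omega
  have hk0 : k = 0 := by omega
  subst hi0; subst hk0
  refine ⟨rfl, rfl, ?_⟩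
  rw [zpow_zero, one_mul, pow_zero, mul_one] at h
  ext i j
  have := congrArg (fun g : G ↦ (g : Matrix (Fin 2) (Fin 2) A) i j) h
  simp only [coe_mapGL_int, Matrix.map_apply] at this
  exact (intCast_injective (p := 3) (by norm_num) this).symm

/-- `Γ* ≤ D*`. [folklore] -/
theorem gammaStar_le_deltaGL (hNM : N = 3 * M) : GammaStar N hbez ≤ DeltaGL M := by
  rw [GammaStar, Subgroup.closure_le]
  rintro g (⟨γ, rfl⟩ | rfl)
  · obtain ⟨t, ht⟩ := dvd_of_mem_Gamma0 γ.2
    refine ⟨((3 * t : ℤ) : A), ?_⟩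
    show ((mapGL A (γ : SL(2, ℤ)) : G) : Matrix (Fin 2) (Fin 2) A) 1 0 = _
    rw [coe_mapGL_int, Matrix.map_apply, ht, hNM, eq_intCast]; push_cast; ring
  · refine ⟨((3 : ℤ) : A), ?_⟩
    show ((WA hbez : G) : Matrix (Fin 2) (Fin 2) A) 1 0 = _
    rw [coe_WA]; simp [Wint]; ring

/-- Entries of `3ᵏ · g`: `(3ᵏ g)ᵢⱼ = 3ᵏ · gᵢⱼ`. [folklore] -/
theorem s3_zpow_mul_apply (k : ℤ) (g : G) (i j : Fin 2) :
    ((s3 ^ k * g : G) : Matrix (Fin 2) (Fin 2) A) i j = ((three ^ k : Aˣ) : A) * g i j := by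
  rw [s3, ← map_zpow, Matrix.GeneralLinearGroup.coe_mul, Matrix.GeneralLinearGroup.coe_scalar,
    Matrix.scalar_apply, ← Matrix.smul_eq_diagonal_mul, Matrix.smul_apply, smul_eq_mul]

variable (Z : AddSubgroup ℚ) (m : Gamma0 N → ℚ) (σ : ℤ) (κ : ℚ) (γ₀ : Gamma0 N)
  (hσ : σ = 1 ∨ σ = -1)
  (hm_mul : ∀ γ γ' : Gamma0 N, m (γ * γ') = m γ + m γ')
  (hm_conj : ∀ γ γ' : Gamma0 N, ((γ' : SL(2, ℤ)) : Matrix (Fin 2) (Fin 2) ℤ) * Wint M x y =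
      Wint M x y * ((γ : SL(2, ℤ)) : Matrix (Fin 2) (Fin 2) ℤ) → m γ' = σ * m γ)
  (hsq : Wint M x y * Wint M x y = (3 : ℤ) • ((γ₀ : SL(2, ℤ)) : Matrix (Fin 2) (Fin 2) ℤ))
  (hκ : (1 + σ) * κ = m γ₀)
  (hconj : ∀ γ : Gamma0 N, ∃ γ' : Gamma0 N,
    ((γ' : SL(2, ℤ)) : Matrix (Fin 2) (Fin 2) ℤ) * Wint M x y = Wint M x y * ((γ : SL(2, ℤ)) : Matrix _ _ ℤ))

include hσ hm_mul hm_conj hsq hκ hconj in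
/-- The subgroup `S ≤ GL₂(ℤ[1/3])` of the orbit trick: normal forms `3ᵏ γ Wⁱ` whose PERIOD VALUE
`m(γ) + i·κ` lies in `Z` (`m` a `W`-`σ`-equivariant homomorphism `Γ₀(N) → ℚ`, `(1+σ)κ = m(W²/3)`);
existential in the representation, so no uniqueness is needed for the group axioms. -/
def periodSubgroup : Subgroup G where
  carrier := {g | ∃ (k : ℤ) (γ : Gamma0 N) (i : ℕ), i ≤ 1 ∧
    g = s3 ^ k * mapGL A (γ : SL(2, ℤ)) * WA hbez ^ i ∧ m γ + i * κ ∈ Z}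
  one_mem' := ⟨0, 1, 0, zero_le_one, by simp, by
    have h1 : m 1 = 0 := by have := hm_mul 1 1; rw [mul_one] at this; linarith
    simp [h1, Z.zero_mem]⟩
  mul_mem' := by
    have hσv : ∀ v : ℚ, v ∈ Z → (σ : ℚ) * v ∈ Z := by
      intro v hv; rcases hσ with rfl | rfl
      · simpa using hv
      · simpa using Z.neg_mem hv
    have hWW : WA hbez * WA hbez = s3 * (mapGL A (γ₀ : SL(2, ℤ)) : G) := WA_mul_WA_eq hbez hsq
    rintro g h ⟨k, γ, i, hi, rfl, hv⟩ ⟨l, γ', j, hj, rfl, hv'⟩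
    interval_cases i
    · refine ⟨k + l, γ * γ', j, hj, ?_, ?_⟩
      · simp only [pow_zero, mul_one, Subgroup.coe_mul, map_mul, zpow_add, mul_assoc]
        rw [← mul_assoc (mapGL A (γ : SL(2, ℤ)) : G) (s3 ^ l), ← s3_zpow_mul_comm l, mul_assoc]
      · rw [hm_mul]; push_cast at hv ⊢
        have := Z.add_mem hv hv'
        simpa [add_assoc] using this
    · obtain ⟨γ'', hγ''⟩ := hconj γ'
      have hc : WA hbez * (mapGL A (γ' : SL(2, ℤ)) : G) = mapGL A (γ'' : SL(2, ℤ)) * WA hbez :=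
        (mapGL_mul_WA_eq hbez hγ'').symm
      have hm'' : m γ'' = σ * m γ' := hm_conj γ' γ'' hγ''
      interval_cases j
      · refine ⟨k + l, γ * γ'', 1, le_rfl, ?_, ?_⟩
        · simp only [pow_zero, mul_one, pow_one, Subgroup.coe_mul, map_mul, zpow_add, mul_assoc]
          rw [← mul_assoc (WA hbez) (s3 ^ l), ← s3_zpow_mul_comm l (WA hbez), mul_assoc, hc,
            ← mul_assoc (mapGL A (γ : SL(2, ℤ)) : G) (s3 ^ l), ← s3_zpow_mul_comm l, mul_assoc]
        · rw [hm_mul, hm'']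
          push_cast at hv hv' ⊢
          have := Z.add_mem hv (hσv _ hv')
          convert this using 1; ring
      · refine ⟨k + l + 1, γ * γ'' * γ₀, 0, zero_le_one, ?_, ?_⟩
        · simp only [pow_zero, mul_one, pow_one, Subgroup.coe_mul, map_mul, zpow_add, zpow_one, mul_assoc]
          rw [← mul_assoc (WA hbez) (s3 ^ l), ← s3_zpow_mul_comm l (WA hbez), mul_assoc,
            ← mul_assoc (WA hbez) (mapGL A (γ' : SL(2, ℤ)) : G), hc, mul_assoc, hWW,
            ← mul_assoc (mapGL A (γ : SL(2, ℤ)) : G) (s3 ^ l), ← s3_zpow_mul_comm l, mul_assoc,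
            ← mul_assoc (mapGL A (γ'' : SL(2, ℤ)) : G) s3, ← zpow_one s3, ← s3_zpow_mul_comm 1, mul_assoc,
            ← mul_assoc (mapGL A (γ : SL(2, ℤ)) : G) (s3 ^ (1 : ℤ)), ← s3_zpow_mul_comm 1, mul_assoc]
        · rw [hm_mul, hm_mul, hm'', ← hκ]
          push_cast at hv hv' ⊢
          have := Z.add_mem hv (hσv _ hv')
          convert this using 1; ring
  inv_mem' := by
    have hσv : ∀ v : ℚ, v ∈ Z → (σ : ℚ) * v ∈ Z := by
      intro v hv; rcases hσ with rfl | rfl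
      · simpa using hv
      · simpa using Z.neg_mem hv
    have hWW : WA hbez * WA hbez = s3 * (mapGL A (γ₀ : SL(2, ℤ)) : G) := WA_mul_WA_eq hbez hsq
    have hm1 : m 1 = 0 := by have := hm_mul 1 1; rw [mul_one] at this; linarith
    have hminv : ∀ γ : Gamma0 N, m γ⁻¹ = -m γ := by
      intro γ; have := hm_mul γ γ⁻¹; rw [mul_inv_cancel, hm1] at this; linarith
    have hWinv : (WA hbez)⁻¹ = s3 ^ (-1 : ℤ) * (mapGL A ((γ₀⁻¹ : Gamma0 N) : SL(2, ℤ)) : G) * WA hbez := by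
      have h1 : (s3 * (mapGL A (γ₀ : SL(2, ℤ)) : G))⁻¹ * (WA hbez * WA hbez) = 1 := by
        rw [hWW, inv_mul_cancel]
      calc (WA hbez)⁻¹ = (s3 * (mapGL A (γ₀ : SL(2, ℤ)) : G))⁻¹ * (WA hbez * WA hbez) * (WA hbez)⁻¹ := by
            rw [h1, one_mul]
        _ = (s3 * (mapGL A (γ₀ : SL(2, ℤ)) : G))⁻¹ * WA hbez := by rw [mul_assoc, mul_inv_cancel_right]
        _ = s3 ^ (-1 : ℤ) * (mapGL A ((γ₀⁻¹ : Gamma0 N) : SL(2, ℤ)) : G) * WA hbez := by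
            rw [mul_inv_rev, Subgroup.coe_inv, map_inv]
            congr 1
            have h2 := s3_zpow_mul_comm (-1) ((mapGL A (γ₀ : SL(2, ℤ)) : G)⁻¹)
            rw [zpow_neg_one] at h2 ⊢
            exact h2.symm
    rintro g ⟨k, γ, i, hi, rfl, hv⟩
    interval_cases i
    · refine ⟨-k, γ⁻¹, 0, zero_le_one, ?_, ?_⟩
      · simp only [pow_zero, mul_one, mul_inv_rev, Subgroup.coe_inv, map_inv, ← zpow_neg]
        rw [s3_zpow_mul_comm]
      · rw [hminv]; push_cast at hv ⊢; simpa using Z.neg_mem hv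
    · obtain ⟨γ'', hγ''⟩ := hconj γ⁻¹
      have hc : WA hbez * (mapGL A ((γ⁻¹ : Gamma0 N) : SL(2, ℤ)) : G) = mapGL A (γ'' : SL(2, ℤ)) * WA hbez :=
        (mapGL_mul_WA_eq hbez hγ'').symm
      have hm'' : m γ'' = σ * m γ⁻¹ := hm_conj γ⁻¹ γ'' hγ''
      refine ⟨-k + -1, γ₀⁻¹ * γ'', 1, le_rfl, ?_, ?_⟩
      · simp only [pow_one, mul_inv_rev, Subgroup.coe_mul, map_mul, zpow_add]
        rw [hWinv, ← map_inv, ← Subgroup.coe_inv, ← zpow_neg]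
        simp only [mul_assoc]
        rw [← mul_assoc (WA hbez) (mapGL A ((γ⁻¹ : Gamma0 N) : SL(2, ℤ)) : G) (s3 ^ (-k)), hc,
          mul_assoc (mapGL A (γ'' : SL(2, ℤ)) : G) (WA hbez) (s3 ^ (-k)), ← s3_zpow_mul_comm (-k) (WA hbez),
          ← mul_assoc (mapGL A (γ'' : SL(2, ℤ)) : G) (s3 ^ (-k)), ← s3_zpow_mul_comm (-k), mul_assoc,
          ← mul_assoc (mapGL A ((γ₀⁻¹ : Gamma0 N) : SL(2, ℤ)) : G) (s3 ^ (-k)), ← s3_zpow_mul_comm (-k),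
          mul_assoc, ← mul_assoc (s3 ^ (-1 : ℤ)) (s3 ^ (-k)), ← zpow_add, add_comm, zpow_add, mul_assoc]
      · rw [hm_mul, hm'', hminv, hminv]
        push_cast at hv ⊢
        have h2 := Z.neg_mem (hσv _ hv)
        convert h2 using 1
        rcases hσ with rfl | rfl
        · push_cast at hκ ⊢; linarith
        · push_cast at hκ ⊢; linarith

include hNM in
/-- **(h1) for `S`**: an element of `Γ* ∩ P*_M` is `3ᵏ γ` with `γ₀₁ = 0` (a `W`-type element cannot fix
`0`: `3 ∣ a` would contradict `det γ = 1`). [folklore] -/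
theorem periodSubgroup_h1 (h_b0 : ∀ γ : Gamma0 N, (γ : SL(2, ℤ)) 0 1 = 0 → m γ ∈ Z) :
    ∀ ⦃g : G⦄, g ∈ GammaStar N hbez → g ∈ lowerGL M →
      g ∈ periodSubgroup hbez Z m σ κ γ₀ hσ hm_mul hm_conj hsq hκ hconj := by
  intro g hg hP
  obtain ⟨k, γ, i, hi, rfl⟩ := exists_normalForm_of_mem hbez hconj ⟨γ₀, hsq⟩ hg
  obtain ⟨h01, -⟩ := hP
  have h01' : ((s3 ^ k * (mapGL A (γ : SL(2, ℤ)) * WA hbez ^ i) : G) : Matrix (Fin 2) (Fin 2) A) 0 1 = 0 := by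
    rw [← mul_assoc]; exact h01
  rw [s3_zpow_mul_apply] at h01'
  have h01'' : ((mapGL A (γ : SL(2, ℤ)) * WA hbez ^ i : G) : Matrix (Fin 2) (Fin 2) A) 0 1 = 0 := by
    exact (Units.mul_right_eq_zero (three ^ k)).mp h01'
  interval_cases i
  · refine ⟨k, γ, 0, zero_le_one, rfl, ?_⟩
    have hb : ((γ : SL(2, ℤ)) 0 1 : ℤ) = 0 := by
      rw [pow_zero, mul_one, coe_mapGL_int, Matrix.map_apply] at h01''
      exact intCast_injective (p := 3) (by norm_num) (by simpa using h01'')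
    simpa using h_b0 γ hb
  · exfalso
    have hval : ((mapGL A (γ : SL(2, ℤ)) * WA hbez ^ 1 : G) : Matrix (Fin 2) (Fin 2) A) 0 1 =
        (((γ : SL(2, ℤ)) 0 0 * y + (γ : SL(2, ℤ)) 0 1 * 3 : ℤ) : A) := by
      rw [pow_one, Matrix.GeneralLinearGroup.coe_mul, Matrix.mul_apply, Fin.sum_univ_two, coe_mapGL_int,
        coe_WA]
      simp [Wint]
    rw [hval] at h01''
    have hZ : ((γ : SL(2, ℤ)) 0 0 * y + (γ : SL(2, ℤ)) 0 1 * 3 : ℤ) = 0 :=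
      intCast_injective (p := 3) (by norm_num) (by simpa using h01'')
    have h3a : (3 : ℤ) ∣ (γ : SL(2, ℤ)) 0 0 := by
      have h3ay : (3 : ℤ) ∣ (γ : SL(2, ℤ)) 0 0 * y := ⟨-(γ : SL(2, ℤ)) 0 1, by linear_combination hZ⟩
      exact (Int.prime_three.dvd_or_dvd h3ay).resolve_right (not_three_dvd_y hbez)
    have hc : (3 : ℤ) ∣ (γ : SL(2, ℤ)) 1 0 :=
      dvd_trans ⟨(M : ℤ), by rw [hNM]; push_cast; ring⟩ (dvd_of_mem_Gamma0 γ.2)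
    have hdet := Matrix.SpecialLinearGroup.det_coe (γ : SL(2, ℤ))
    rw [Matrix.det_fin_two] at hdet
    have : (3 : ℤ) ∣ 1 := by
      rw [← hdet]; exact dvd_sub (dvd_mul_of_dvd_left h3a _) (dvd_mul_of_dvd_right hc _)
    omega

include hNM in
/-- **(h2) for `S`**: an element `x = b q` of `Γ*` (`b ∈ B*`, `q ∈ P*`) has a unit `(1,1)`-entry; for
`x = 3ᵏ γ` this forces `d = ±1`, for `x = 3ᵏ γ W` it forces `|c y + 3 d| = 3ᵉ`, `e ≥ 1`. [folklore] -/
theorem periodSubgroup_h2 (h_d1 : ∀ γ : Gamma0 N, ((γ : SL(2, ℤ)) 1 1 = 1 ∨ (γ : SL(2, ℤ)) 1 1 = -1) → m γ ∈ Z)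
    (h_W : ∀ γ : Gamma0 N,
      (∃ e : ℕ, 1 ≤ e ∧ ((γ : SL(2, ℤ)) 1 0 * y + (γ : SL(2, ℤ)) 1 1 * 3 : ℤ).natAbs = 3 ^ e) → m γ + κ ∈ Z) :
    ∀ ⦃g b q : G⦄, g ∈ GammaStar N hbez → b ∈ upperGL → q ∈ lowerGL M → g = b * q →
      g ∈ periodSubgroup hbez Z m σ κ γ₀ hσ hm_mul hm_conj hsq hκ hconj := by
  intro g b q hg hb hq hgbq
  obtain ⟨k, γ, i, hi, rfl⟩ := exists_normalForm_of_mem hbez hconj ⟨γ₀, hsq⟩ hg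
  -- the `(1,1)` entry of `b q` is a unit
  have hb' : (b : Matrix (Fin 2) (Fin 2) A) 1 0 = 0 := hb
  have hq' : (q : Matrix (Fin 2) (Fin 2) A) 0 1 = 0 := hq.1
  have hbu : IsUnit ((b : Matrix (Fin 2) (Fin 2) A) 1 1) := by
    have hd : IsUnit (Matrix.det (b : Matrix (Fin 2) (Fin 2) A)) := by
      rw [← Matrix.GeneralLinearGroup.val_det_apply]; exact Units.isUnit _
    rw [Matrix.det_fin_two, hb', mul_zero, sub_zero] at hd
    exact isUnit_of_mul_isUnit_right hd
  have hqu : IsUnit ((q : Matrix (Fin 2) (Fin 2) A) 1 1) := by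
    have hd : IsUnit (Matrix.det (q : Matrix (Fin 2) (Fin 2) A)) := by
      rw [← Matrix.GeneralLinearGroup.val_det_apply]; exact Units.isUnit _
    rw [Matrix.det_fin_two, hq', zero_mul, sub_zero] at hd
    exact isUnit_of_mul_isUnit_right hd
  have hu : IsUnit (((s3 ^ k * mapGL A (γ : SL(2, ℤ)) * WA hbez ^ i : G) : Matrix (Fin 2) (Fin 2) A) 1 1) := by
    rw [hgbq, Matrix.GeneralLinearGroup.coe_mul, Matrix.mul_apply, Fin.sum_univ_two, hb', zero_mul, zero_add]
    exact hbu.mul hqu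
  rw [mul_assoc, s3_zpow_mul_apply] at hu
  have hu' : IsUnit (((mapGL A (γ : SL(2, ℤ)) * WA hbez ^ i : G) : Matrix (Fin 2) (Fin 2) A) 1 1) :=
    isUnit_of_mul_isUnit_right hu
  interval_cases i
  · refine ⟨k, γ, 0, zero_le_one, rfl, ?_⟩
    rw [pow_zero, mul_one, coe_mapGL_int, Matrix.map_apply] at hu'
    obtain ⟨e, he⟩ := natAbs_eq_pow_of_isUnit_intCast (p := 3) Nat.prime_three (by simpa using hu')
    have he0 : e = 0 := by
      by_contra hne
      have h3d : (3 : ℤ) ∣ (γ : SL(2, ℤ)) 1 1 := by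
        rw [← Int.natAbs_dvd_natAbs]; rw [he]
        exact dvd_pow_self 3 hne
      exact not_three_dvd_d hNM γ h3d
    rw [he0, pow_zero] at he
    have hd : (γ : SL(2, ℤ)) 1 1 = 1 ∨ (γ : SL(2, ℤ)) 1 1 = -1 := by
      rcases Int.natAbs_eq ((γ : SL(2, ℤ)) 1 1) with h | h <;> rw [he] at h
      · left; exact_mod_cast h
      · right; exact_mod_cast h
    simpa using h_d1 γ hd
  · refine ⟨k, γ, 1, le_rfl, rfl, ?_⟩
    have hval : ((mapGL A (γ : SL(2, ℤ)) * WA hbez ^ 1 : G) : Matrix (Fin 2) (Fin 2) A) 1 1 =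
        (((γ : SL(2, ℤ)) 1 0 * y + (γ : SL(2, ℤ)) 1 1 * 3 : ℤ) : A) := by
      rw [pow_one, Matrix.GeneralLinearGroup.coe_mul, Matrix.mul_apply, Fin.sum_univ_two, coe_mapGL_int,
        coe_WA]
      simp [Wint]
    rw [hval] at hu'
    obtain ⟨e, he⟩ := natAbs_eq_pow_of_isUnit_intCast (p := 3) Nat.prime_three hu'
    have hc : (3 : ℤ) ∣ (γ : SL(2, ℤ)) 1 0 :=
      dvd_trans ⟨(M : ℤ), by rw [hNM]; push_cast; ring⟩ (dvd_of_mem_Gamma0 γ.2)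
    have he1 : 1 ≤ e := by
      by_contra hlt
      have he0 : e = 0 := by omega
      rw [he0, pow_zero] at he
      have h3 : (3 : ℤ) ∣ ((γ : SL(2, ℤ)) 1 0 * y + (γ : SL(2, ℤ)) 1 1 * 3 : ℤ) :=
        dvd_add (dvd_mul_of_dvd_left hc _) (dvd_mul_left _ _)
      have : (3 : ℤ).natAbs ∣ 1 := by rw [← he]; exact Int.natAbs_dvd_natAbs.mpr h3
      norm_num at this
    push_cast
    rw [one_mul]
    exact h_W γ ⟨e, he1, he⟩

include hbez hNM h3M hM hσ hm_mul hm_conj hsq hκ hconj in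
/-- **THE KERNEL THEOREM (Atkin–Lehner-extended orbit trick at a multiplicative level `N = 3M`).**
For a `W`-`σ`-equivariant homomorphism `m : Γ₀(N) → ℚ` with `(1+σ)κ = m(W²/3)` and a subgroup `Z ≤ ℚ`
containing `m γ` whenever `γ₀₁ = 0` or `d(γ) = ±1`, and `m γ + κ` whenever `|c y + 3 d| = 3ᵉ`
(`e ≥ 1`): `m γ ∈ Z` for EVERY `γ ∈ Γ₀(N)` with `d ≡ ±3ᵏ (mod M)` — by Vaserstein's (V) over `ℤ[1/3]`,
the orbit trick in `GL₂(ℤ[1/3])` with `Γ* = ⟨Γ₀(N), W⟩`, and the uniqueness of the trivial normal form.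
[cite: Vaserstein1972SL2, Theorem, p. 313] [cite: Manin1972, Prop. 1.4] -/
theorem mem_of_orbitTrick
    (h_b0 : ∀ γ : Gamma0 N, (γ : SL(2, ℤ)) 0 1 = 0 → m γ ∈ Z)
    (h_d1 : ∀ γ : Gamma0 N, ((γ : SL(2, ℤ)) 1 1 = 1 ∨ (γ : SL(2, ℤ)) 1 1 = -1) → m γ ∈ Z)
    (h_W : ∀ γ : Gamma0 N,
      (∃ e : ℕ, 1 ≤ e ∧ ((γ : SL(2, ℤ)) 1 0 * y + (γ : SL(2, ℤ)) 1 1 * 3 : ℤ).natAbs = 3 ^ e) → m γ + κ ∈ Z)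
    (γ : Gamma0 N) (γM : Gamma0 M) (hγM : (γM : SL(2, ℤ)) = γ) (hH : InGammaH M 3 γM) :
    m γ ∈ Z := by
  have hx := mapGL_mem_closure_upper_lower hM γM hH
  rw [hγM] at hx
  have key := OrbitTrick.mem_of_mem_closure (Γ := GammaStar N hbez) (B := upperGL) (P := lowerGL M)
    (D := DeltaGL M) (S := periodSubgroup hbez Z m σ κ γ₀ hσ hm_mul hm_conj hsq hκ hconj)
    (upperGL_le_DeltaGL M) (lowerGL_le_DeltaGL M) (gammaStar_le_deltaGL hbez hNM)
    (periodSubgroup_h1 hbez hNM Z m σ κ γ₀ hσ hm_mul hm_conj hsq hκ hconj h_b0)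
    (periodSubgroup_h2 hbez hNM Z m σ κ γ₀ hσ hm_mul hm_conj hsq hκ hconj h_d1 h_W)
    (fun _ hd ↦ deltaGL_eq_gammaStar_mul_upperGL hbez hNM h3M hd)
    (fun _ hd ↦ deltaGL_eq_gammaStar_mul_lowerGL hbez hNM h3M hd)
    (mapGL_mem_GammaStar hbez γ) hx
  obtain ⟨k, γ', i, hi, hEq, hv⟩ := key
  obtain ⟨rfl, rfl, rfl⟩ := normalForm_unique hbez hi hEq
  simpa using hv

end Kernel

end

end Summit.BirchSwinnertonDyer.BirchSwinnertonDyer.Theorems.MultThreeOrbit
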